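import Mathlib
import HarnessLib

/-!
# `OneFlightGossipEngine.OneFlightLayeredChaos` — disc flatness from translation quasi-invariance (measure form)
(crux stmt-AtomisticToContinuum-14535, line `Sketch`, lead cycle c3; disc-form reduction 4/4; registered stub
`disc_flat_of_quasiInvariant`)

The Mathlib-only brick behind the line's FLUX → DISC frame (`…DiscRegimes.lean`, `…DiscTransfer.lean`): the event-level
disc-uniformity `RegimeDiscBody` is obtained fibrewise in `ĝ` from translation quasi-invariance of the law of the
transverse offset.  For a finite measure `μ` on `ℝ²` and the closed unit disc `D`: if translating any measurable `A ⊆ D`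
by any `δ` keeping it inside `D` changes its mass by at most `η`, then `μ` is `4η`-close to `μ(D) ·` (uniform law of
`D`) on every measurable `S ⊆ D`:

  `|μ(S) − μ(D) · |S|/|D|| ≤ 4 η`.

Proof: with `T₁ = {(δ, y) | y ∈ S, y − δ ∈ D}` and `T₂ = {(δ, y) | y + δ ∈ S, y ∈ D}`, Tonelli gives
`(vol ⊗ μ)(T₁) = |D| μ(S)` (the `δ`-slice at `y` is the disc `closedBall y 1`) and `(vol ⊗ μ)(T₂) = |S| μ(D)`
(translation invariance of Lebesgue measure); for each `δ` the `μ`-slices of `T₁` and `T₂` are `A + δ` and `A` with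
`A = (S − δ) ∩ D ⊆ D`, `A + δ = S ∩ (D + δ) ⊆ D`, so they differ in mass by `≤ η` when `‖δ‖ ≤ 2` and are both empty
otherwise; integrating, `||D| μ(S) − |S| μ(D)| ≤ η |B(0, 2)| = 4 η |D|`.
-/

open MeasureTheory Set Metric
open scoped ENNReal

namespace Summit.AtomisticToContinuum.HydrodynamicLimit.Theorems.OLC

noncomputable section

/-- **Disc flatness from translation quasi-invariance (measure form)** (registered stub `disc_flat_of_quasiInvariant`
of crux stmt-AtomisticToContinuum-14535, line `Sketch`). For a finite measure `μ` on `ℝ²` and the closed unit disc `D`,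
if `|μ(A + δ) − μ(A)| ≤ η` for every `δ` and every measurable `A ⊆ D` with `A + δ ⊆ D`, then for every measurable
`S ⊆ D`: `|μ(S) − μ(D) · vol(S)/vol(D)| ≤ 4 η` (the mass of `μ` outside `D` never enters). Tonelli on the two product
sets `T₁, T₂` of the module docstring. [folklore] -/
theorem disc_flat_of_quasiInvariant : ∀ (μ : MeasureTheory.Measure (EuclideanSpace ℝ (Fin 2))) [MeasureTheory.IsFiniteMeasure μ] {η : ℝ}, 0 ≤ η → (∀ (δ : EuclideanSpace ℝ (Fin 2)) (A : Set (EuclideanSpace ℝ (Fin 2))), MeasurableSet A → A ⊆ Metric.closedBall (0 : EuclideanSpace ℝ (Fin 2)) 1 → (fun y => y + δ) '' A ⊆ Metric.closedBall (0 : EuclideanSpace ℝ (Fin 2)) 1 → |μ.real ((fun y => y + δ) '' A) - μ.real A| ≤ η) → ∀ {S : Set (EuclideanSpace ℝ (Fin 2))}, MeasurableSet S → S ⊆ Metric.closedBall (0 : EuclideanSpace ℝ (Fin 2)) 1 → |μ.real S - μ.real (Metric.closedBall (0 : EuclideanSpace ℝ (Fin 2)) 1) * (MeasureTheory.volume.real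 S / MeasureTheory.volume.real (Metric.closedBall (0 : EuclideanSpace ℝ (Fin 2)) 1))| ≤ 4 * η := by
  intro μ _ η hη h S hS hSD
  set D : Set (EuclideanSpace ℝ (Fin 2)) := closedBall (0 : (EuclideanSpace ℝ (Fin 2))) 1 with hD
  have hDm : MeasurableSet D := isClosed_closedBall.measurableSet
  -- the two product sets
  set T₁ : Set ((EuclideanSpace ℝ (Fin 2)) × (EuclideanSpace ℝ (Fin 2))) := {p | p.2 ∈ S ∧ p.2 - p.1 ∈ D} with hT₁
  set T₂ : Set ((EuclideanSpace ℝ (Fin 2)) × (EuclideanSpace ℝ (Fin 2))) := {p | p.2 + p.1 ∈ S ∧ p.2 ∈ D} with hT₂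
  have hT₁m : MeasurableSet T₁ :=
    (hS.preimage measurable_snd).inter (hDm.preimage (measurable_snd.sub measurable_fst))
  have hT₂m : MeasurableSet T₂ :=
    (hS.preimage (measurable_snd.add measurable_fst)).inter (hDm.preimage measurable_snd)
  -- Tonelli, integrating `δ` first: `(vol ⊗ μ) T₁ = vol D * μ S`, `(vol ⊗ μ) T₂ = vol S * μ D`
  have hI₁ : (volume.prod μ) T₁ = volume D * μ S := by
    rw [Measure.prod_apply_symm hT₁m]
    have hfun : (fun y : (EuclideanSpace ℝ (Fin 2)) => volume ((fun x : (EuclideanSpace ℝ (Fin 2)) => (x, y)) ⁻¹' T₁)) = fun y => S.indicator (fun _ => volume D) y := by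
      funext y
      by_cases hy : y ∈ S
      · have hslice : (fun x : (EuclideanSpace ℝ (Fin 2)) => (x, y)) ⁻¹' T₁ = closedBall y 1 := by
          ext x
          simp only [hT₁, hD, mem_preimage, mem_setOf_eq, hy, true_and, mem_closedBall, dist_eq_norm,
            norm_sub_rev, sub_zero]
        rw [hslice, indicator_of_mem hy, hD, Measure.addHaar_closedBall_center]
      · have hslice : (fun x : (EuclideanSpace ℝ (Fin 2)) => (x, y)) ⁻¹' T₁ = ∅ := by
          ext x
          simp [hT₁, hy]
        rw [hslice, indicator_of_notMem hy, measure_empty]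
    rw [hfun, lintegral_indicator_const hS]
  have hI₂ : (volume.prod μ) T₂ = volume S * μ D := by
    rw [Measure.prod_apply_symm hT₂m]
    have hfun : (fun y : (EuclideanSpace ℝ (Fin 2)) => volume ((fun x : (EuclideanSpace ℝ (Fin 2)) => (x, y)) ⁻¹' T₂)) = fun y => D.indicator (fun _ => volume S) y := by
      funext y
      by_cases hy : y ∈ D
      · rw [indicator_of_mem hy]
        have : (fun x : (EuclideanSpace ℝ (Fin 2)) => (x, y)) ⁻¹' T₂ = (fun x : (EuclideanSpace ℝ (Fin 2)) => y + x) ⁻¹' S := by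
          ext x; simp [hT₂, hy]
        rw [this, measure_preimage_add]
      · rw [indicator_of_notMem hy]
        have : (fun x : (EuclideanSpace ℝ (Fin 2)) => (x, y)) ⁻¹' T₂ = ∅ := by
          ext x; simp [hT₂, hy]
        rw [this, measure_empty]
    rw [hfun, lintegral_indicator_const hDm]
  -- the `μ`-slices at fixed `δ`: `A + δ` and `A`
  have hslices : ∀ δ : (EuclideanSpace ℝ (Fin 2)),
      μ (Prod.mk δ ⁻¹' T₁) ≤ μ (Prod.mk δ ⁻¹' T₂) + (closedBall (0 : (EuclideanSpace ℝ (Fin 2))) 2).indicator (fun _ => ENNReal.ofReal η) δ ∧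
      μ (Prod.mk δ ⁻¹' T₂) ≤ μ (Prod.mk δ ⁻¹' T₁) + (closedBall (0 : (EuclideanSpace ℝ (Fin 2))) 2).indicator (fun _ => ENNReal.ofReal η) δ := by
    intro δ
    have hA : Prod.mk δ ⁻¹' T₂ = {y | y + δ ∈ S ∧ y ∈ D} := rfl
    have hA' : Prod.mk δ ⁻¹' T₁ = {y | y ∈ S ∧ y - δ ∈ D} := rfl
    by_cases hδ : δ ∈ closedBall (0 : (EuclideanSpace ℝ (Fin 2))) 2
    · rw [indicator_of_mem hδ]
      have hAm : MeasurableSet (Prod.mk δ ⁻¹' T₂) := measurable_prodMk_left hT₂m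
      have hAD : Prod.mk δ ⁻¹' T₂ ⊆ D := fun y hy => hy.2
      have himage : (fun y => y + δ) '' (Prod.mk δ ⁻¹' T₂) = Prod.mk δ ⁻¹' T₁ := by
        rw [hA, hA']
        ext x
        simp only [mem_image, mem_setOf_eq]
        constructor
        · rintro ⟨y, ⟨hyS, hyD⟩, rfl⟩
          exact ⟨hyS, by simpa using hyD⟩
        · rintro ⟨hxS, hxD⟩
          exact ⟨x - δ, ⟨by simpa using hxS, hxD⟩, by simp⟩
      have himD : (fun y => y + δ) '' (Prod.mk δ ⁻¹' T₂) ⊆ D := by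
        rw [himage, hA']; exact fun y hy => hSD hy.1
      have key := h δ _ hAm hAD himD
      rw [himage] at key
      have h1 : μ.real (Prod.mk δ ⁻¹' T₁) ≤ μ.real (Prod.mk δ ⁻¹' T₂) + η := by linarith [(abs_le.1 key).2]
      have h2 : μ.real (Prod.mk δ ⁻¹' T₂) ≤ μ.real (Prod.mk δ ⁻¹' T₁) + η := by linarith [(abs_le.1 key).1]
      constructor
      · have := ENNReal.ofReal_le_ofReal h1
        rwa [ENNReal.ofReal_add measureReal_nonneg hη, ofReal_measureReal, ofReal_measureReal] at this
      · have := ENNReal.ofReal_le_ofReal h2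
        rwa [ENNReal.ofReal_add measureReal_nonneg hη, ofReal_measureReal, ofReal_measureReal] at this
    · -- far shifts: both slices are empty
      rw [indicator_of_notMem hδ, add_zero, add_zero]
      have hfar : 2 < ‖δ‖ := by simpa [mem_closedBall, dist_zero_right] using hδ
      have he1 : Prod.mk δ ⁻¹' T₁ = ∅ := by
        rw [hA']
        ext y
        simp only [mem_setOf_eq, mem_empty_iff_false, iff_false, not_and]
        intro hyS hyD
        have h1 : ‖y‖ ≤ 1 := by simpa [hD] using hSD hyS
        have h2 : ‖y - δ‖ ≤ 1 := by simpa [hD] using hyD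
        have : ‖δ‖ ≤ ‖y‖ + ‖y - δ‖ := by
          calc ‖δ‖ = ‖y - (y - δ)‖ := by rw [sub_sub_cancel]
            _ ≤ ‖y‖ + ‖y - δ‖ := norm_sub_le _ _
        linarith
      have he2 : Prod.mk δ ⁻¹' T₂ = ∅ := by
        rw [hA]
        ext y
        simp only [mem_setOf_eq, mem_empty_iff_false, iff_false, not_and]
        intro hyS hyD
        have h1 : ‖y + δ‖ ≤ 1 := by simpa [hD] using hSD hyS
        have h2 : ‖y‖ ≤ 1 := by simpa [hD] using hyD
        have : ‖δ‖ ≤ ‖y + δ‖ + ‖y‖ := by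
          calc ‖δ‖ = ‖(y + δ) - y‖ := by rw [add_sub_cancel_left]
            _ ≤ ‖y + δ‖ + ‖y‖ := norm_sub_le _ _
        linarith
      rw [he1, he2]
      exact ⟨le_rfl, le_rfl⟩
  -- integrate the slice inequalities over `δ`
  have hB2m : MeasurableSet (closedBall (0 : (EuclideanSpace ℝ (Fin 2))) 2) := isClosed_closedBall.measurableSet
  have hmeas₁ : Measurable fun δ : (EuclideanSpace ℝ (Fin 2)) => μ (Prod.mk δ ⁻¹' T₁) := measurable_measure_prodMk_left hT₁m
  have hmeas₂ : Measurable fun δ : (EuclideanSpace ℝ (Fin 2)) => μ (Prod.mk δ ⁻¹' T₂) := measurable_measure_prodMk_left hT₂m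
  have hind : Measurable fun δ : (EuclideanSpace ℝ (Fin 2)) => (closedBall (0 : (EuclideanSpace ℝ (Fin 2))) 2).indicator (fun _ => ENNReal.ofReal η) δ :=
    measurable_const.indicator hB2m
  have hvolB2 : volume (closedBall (0 : (EuclideanSpace ℝ (Fin 2))) 2) = 4 * volume D := by
    rw [hD, Measure.addHaar_closedBall' volume (0 : (EuclideanSpace ℝ (Fin 2))) (by norm_num : (0 : ℝ) ≤ 2), finrank_euclideanSpace_fin]
    norm_num
  have hJ₁ : volume D * μ S ≤ volume S * μ D + ENNReal.ofReal η * (4 * volume D) := by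
    calc volume D * μ S = ∫⁻ δ, μ (Prod.mk δ ⁻¹' T₁) ∂volume := by rw [← hI₁, Measure.prod_apply hT₁m]
      _ ≤ ∫⁻ δ, (μ (Prod.mk δ ⁻¹' T₂) + (closedBall (0 : (EuclideanSpace ℝ (Fin 2))) 2).indicator (fun _ => ENNReal.ofReal η) δ) ∂volume :=
          lintegral_mono fun δ => (hslices δ).1
      _ = (volume.prod μ) T₂ + ENNReal.ofReal η * volume (closedBall (0 : (EuclideanSpace ℝ (Fin 2))) 2) := by
          rw [lintegral_add_left hmeas₂, lintegral_indicator_const hB2m, Measure.prod_apply hT₂m]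
      _ = volume S * μ D + ENNReal.ofReal η * (4 * volume D) := by rw [hI₂, hvolB2]
  have hJ₂ : volume S * μ D ≤ volume D * μ S + ENNReal.ofReal η * (4 * volume D) := by
    calc volume S * μ D = ∫⁻ δ, μ (Prod.mk δ ⁻¹' T₂) ∂volume := by rw [← hI₂, Measure.prod_apply hT₂m]
      _ ≤ ∫⁻ δ, (μ (Prod.mk δ ⁻¹' T₁) + (closedBall (0 : (EuclideanSpace ℝ (Fin 2))) 2).indicator (fun _ => ENNReal.ofReal η) δ) ∂volume :=
          lintegral_mono fun δ => (hslices δ).2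
      _ = (volume.prod μ) T₁ + ENNReal.ofReal η * volume (closedBall (0 : (EuclideanSpace ℝ (Fin 2))) 2) := by
          rw [lintegral_add_left hmeas₁, lintegral_indicator_const hB2m, Measure.prod_apply hT₁m]
      _ = volume D * μ S + ENNReal.ofReal η * (4 * volume D) := by rw [hI₁, hvolB2]
  -- pass to real numbers
  have hDfin : volume D ≠ ⊤ := by rw [hD]; exact measure_closedBall_lt_top.ne
  have hDpos : 0 < volume.real D := by
    rw [measureReal_def]
    exact ENNReal.toReal_pos (by rw [hD]; exact (Metric.measure_closedBall_pos volume (0 : (EuclideanSpace ℝ (Fin 2))) one_pos).ne') hDfin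
  have hSfin : volume S ≠ ⊤ := (measure_ne_top_of_subset hSD hDfin)
  have hr₁ : volume.real D * μ.real S ≤ volume.real S * μ.real D + η * (4 * volume.real D) := by
    have := ENNReal.toReal_mono (by
      exact ENNReal.add_ne_top.2 ⟨ENNReal.mul_ne_top hSfin (measure_ne_top _ _),
        ENNReal.mul_ne_top ENNReal.ofReal_ne_top (ENNReal.mul_ne_top (by norm_num) hDfin)⟩) hJ₁
    rw [ENNReal.toReal_add (ENNReal.mul_ne_top hSfin (measure_ne_top _ _))
        (ENNReal.mul_ne_top ENNReal.ofReal_ne_top (ENNReal.mul_ne_top (by norm_num) hDfin)),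
      ENNReal.toReal_mul, ENNReal.toReal_mul, ENNReal.toReal_mul, ENNReal.toReal_mul, ENNReal.toReal_ofReal hη] at this
    simpa [measureReal_def] using this
  have hr₂ : volume.real S * μ.real D ≤ volume.real D * μ.real S + η * (4 * volume.real D) := by
    have := ENNReal.toReal_mono (by
      exact ENNReal.add_ne_top.2 ⟨ENNReal.mul_ne_top hDfin (measure_ne_top _ _),
        ENNReal.mul_ne_top ENNReal.ofReal_ne_top (ENNReal.mul_ne_top (by norm_num) hDfin)⟩) hJ₂
    rw [ENNReal.toReal_add (ENNReal.mul_ne_top hDfin (measure_ne_top _ _))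
        (ENNReal.mul_ne_top ENNReal.ofReal_ne_top (ENNReal.mul_ne_top (by norm_num) hDfin)),
      ENNReal.toReal_mul, ENNReal.toReal_mul, ENNReal.toReal_mul, ENNReal.toReal_mul, ENNReal.toReal_ofReal hη] at this
    simpa [measureReal_def] using this
  -- divide by `vol D > 0`
  have hq : μ.real D * (volume.real S / volume.real D) = volume.real S * μ.real D / volume.real D := by ring
  rw [hq, abs_le]
  constructor
  · -- lower bound: `vol S μ D / vol D ≤ μ S + 4η`
    have : volume.real S * μ.real D / volume.real D ≤ μ.real S + 4 * η := by
      rw [div_le_iff₀ hDpos]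
      linarith
    linarith
  · -- upper bound: `μ S - 4η ≤ vol S μ D / vol D`
    have : μ.real S - 4 * η ≤ volume.real S * μ.real D / volume.real D := by
      rw [le_div_iff₀ hDpos]
      linarith
    linarith

end

end Summit.AtomisticToContinuum.HydrodynamicLimit.Theorems.OLC
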